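import Summits.BirchSwinnertonDyer.BirchSwinnertonDyer.Theorems.SchneiderFreeAdditiveX3PoitouTatePresentationRoad
import Summits.BirchSwinnertonDyer.BirchSwinnertonDyer.Theorems.SchneiderFreeAdditiveX3PoitouTateAllPlacesTateDual
import Summits.BirchSwinnertonDyer.BirchSwinnertonDyer.Theorems.SchneiderFreeAdditiveX3PoitouTateBidualTransport
import Literature.NumberTheory.GaloisRepresentations.HomDualLocalData
import Literature.NumberTheory.GaloisRepresentations.GaloisRepUnramifiedProofs
import Literature.Algebra.Homology.DiscreteRepTateDuality
import HarnessLib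

/-!
# Poitou–Tate toolkit: the presentation road INSTANTIATED — `hA` (all places, Tate duals) and hence
# `poitouTate_selmerStructure_duality K` from Tate duality for `(Γ_K, C̄)`, an idèle projection family,
# the idèle ASSEMBLY (R3) and the pairing dictionary (R4)

Cell `bsd-schneider-ideate`, seat `bsd-schneider-door-c6` (prover, generation 17).  PARTITION: board row
B6 ∩ X3 ∩ sst-twist, `r = 1`, of `Rank1Residual.partition` — CONTROL corner (crux `AnticycControlAdditiveK`,
stmt-BirchSwinnertonDyer-19295; facts binder `ControlFacts` (i) = `poitouTate_selmerStructure_duality K`).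
bears_on: K1-door (r1, B6∩X3-sst) (route-BirchSwinnertonDyer-SchneiderFreeAdditiveX3 item 18969).  THEOREMS ONLY;
closes nothing by itself (BSD is not advanced; no case of Poitou–Tate is proved here — the remaining inputs are
explicit hypotheses on existing objects).

WHAT IS NEW relative to `middleExact_allPlaces_of_readout` (gen 16, `…PoitouTatePresentationRoad`):
(1) `middleExact_allPlaces_of_readout_inv` — the road for an ARBITRARY invariant map `inv : Ext²_{C_Γ}(ℤ, C̄) →+ ℚ/ℤ`
(gen 16 hard-wired `classBarInv K`; door-c4's Tate-duality record is for the spelling `classBarInvD K`).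
(2) `middleExact_allPlaces_tateDual_of_ideleProjection` — the road RUN on door-c4's canonical presentation of a finite
`n`-torsion `ρ₀` (`FreePresentation.presentationComplex ρ₀`) with module `ρ := ρ₀.tateDual n` and the readout
`R_v := HomDual.readout ρ₀ n hM (π v)` (`HomDualIdeleReadout`) of a family of idèle projections `π v : J̄ → K̄_vˣ`:
`hS`, `hP`, `hR1`, `hR2` are DISCHARGED, `hα` comes from `TateDualityHypotheses (classBarD K) inv`; (R3) and (R4) remain.
(3) `exists_readout_eq_of_assembly` — (R3) from the LOCAL data of `HomDualLocalData` (Milne I Lemma 4.13: every local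
class is a local readout, unit-valued at the unramified places) and the pure idèle ASSEMBLY statement (door-c5).
(4) `poitouTate_selmerStructure_duality_of_ideleProjection` / `…_of_assembly` — THE NAMED FACT `hE` from
{Tate duality for `(Γ_K, C̄, inv)`, one idèle projection family (+ ASSEMBLY), (R4)} via gen 16's
`poitouTate_selmerStructure_duality_of_allPlaces_tateDual`.

References: [MilneADT2006] I Lemma 4.13, Thm. 4.10 (b) and its proof (p. 58), Thm. 1.8; [Harari2020] §16.3, §17.3
(Thm. 17.13); [CasselsFrohlichANT1967] Ch. VII §8–§9.
-/

noncomputable section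

open Function NumberField IsDedekindDomain CategoryTheory CategoryTheory.Abelian
open scoped NumberField

set_option linter.dupNamespace false
set_option autoImplicit false

namespace Summit.BirchSwinnertonDyer.BirchSwinnertonDyer.Theorems.SchneiderFreeAdditiveX3.PoitouTateReduction

open Field
open Literature.NumberTheory.GaloisRepresentations Literature.NumberTheory.GaloisCohomology
open Literature.NumberTheory.GaloisRepresentations.DiscreteGaloisModule (mu TateDual tateDual
  localTatePairingZMod unramifiedSubgroup)
open Literature.Algebra.Homology Literature.Algebra.Homology.DiscreteRep Literature.Algebra.Homology.ExtPresentation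
open Literature.NumberTheory.GaloisRepresentations.IdeleClassBar (classBarD)
open Literature.NumberTheory.GaloisRepresentations.FreePresentation (presentationComplex presentationComplex_shortExact
  ext_presLattice_unitsBarD_eq_zero presentationLayer presentationRank)
open Literature.NumberTheory.GaloisRepresentations.HomDual (IdeleProjection readout readout_f_comp
  exists_forall_readout_comp_unitsToIdele_eq readoutInvariant localReadout localReadout_surjective
  exists_unitValued_localReadout_eq readout_eq_localReadout charZero_of_algebra)
open Literature.NumberTheory.GaloisRepresentations.FreePresentation (presModule₁ moduleFinite_presModule₁)
open Literature.NumberTheory.GaloisRepresentations.DGMBridge (LCarrier)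

variable {K : Type} [Field K] [NumberField K]

/-! ## §1 The road for an arbitrary invariant map -/

section Inv

variable {n : ℕ} [NeZero n]
variable {M : Type} [AddCommGroup M] [TopologicalSpace M] [DiscreteTopology M] [Finite M]
variable (inv : Abelian.Ext (triv (Γ := absoluteGaloisGroup K) ℤ) (classBarD K) 2 →+ AddCircle (1 : ℚ))

/-- `α¹_inv(∂ u) = 0` from the vanishing of all pairings, for an arbitrary invariant map `inv`.
[cite: Harari2020, §16.3][cite: MilneADT2006, Ch. I, Thm. 4.10 (proof)] -/
theorem adjointMap_eq_zero_of_forall_inv {S : ShortComplex (DiscreteRepCat ℤ (absoluteGaloisGroup K))}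
    (x : Abelian.Ext S.X₃ (classBarD K) 1)
    (h : ∀ ŷ : Abelian.Ext (triv (Γ := absoluteGaloisGroup K) ℤ) S.X₃ 1, inv (ŷ.comp x (rfl : 1 + 1 = 2)) = 0) :
    ExtDuality.adjointMap (P := triv (Γ := absoluteGaloisGroup K) ℤ) inv S.X₃ (rfl : 1 + 1 = 2) x = 0 := by
  ext ŷ
  rw [ExtDuality.pairing_apply, AddMonoidHom.zero_apply]
  exact h ŷ

/-- **Milne I Thm. 4.10(b), `r = 1`, `Ker γ¹ ⊆ Im β¹` over ALL places, from a presentation, `α¹`-injectivity for an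
ARBITRARY invariant map `inv` of `C̄`, and a readout with (R1)–(R4)** — `middleExact_allPlaces_of_readout` with
`classBarInv K` replaced by `inv` throughout (same proof).
[cite: MilneADT2006, Ch. I, Lemma 4.13 and Thm. 4.10(b) (proof, p. 58)][cite: Harari2020, §17.3, Thm. 17.13] -/
theorem middleExact_allPlaces_of_readout_inv (ρ : DiscreteGaloisModule K M)
    {S : ShortComplex (DiscreteRepCat ℤ (absoluteGaloisGroup K))} (hS : S.ShortExact)
    (hP : ∀ x : Abelian.Ext S.X₂ (ideleClassLimitShortComplex K).X₁ 1, x = 0)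
    (hα : ExtDuality.AdjointInjective (P := triv (Γ := absoluteGaloisGroup K) ℤ) inv S.X₃ (rfl : 1 + 1 = 2))
    (R : ∀ v : Place K, (S.X₁ ⟶ (ideleClassLimitShortComplex K).X₂) →+ galoisCohomology (ρ.toLocal v) 1)
    (hR1 : ∀ (q : S.X₂ ⟶ (ideleClassLimitShortComplex K).X₂) (v : Place K), R v (S.f ≫ q) = 0)
    (hR2 : ∀ h : S.X₁ ⟶ (ideleClassLimitShortComplex K).X₁, ∃ x : galoisCohomology ρ 1,
      ∀ v : Place K, R v (h ≫ (ideleClassLimitShortComplex K).f) = galoisCohomology.localization ρ v 1 x)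
    (hR3 : ∀ T : Finset (Place K), (∀ w : InfinitePlace K, (Sum.inl w : Place K) ∈ T) →
      (∀ v : HeightOneSpectrum (𝓞 K), (Sum.inr v : Place K) ∉ T →
        ((n : ℕ) : 𝓞 K) ∉ v.asIdeal ∧ GaloisRep.IsUnramifiedAt v ρ) →
      ∀ t : Π v : Place K, galoisCohomology (ρ.toLocal v) 1,
        (∀ v : HeightOneSpectrum (𝓞 K), (Sum.inr v : Place K) ∉ T →
          t (Sum.inr v) ∈ unramifiedSubgroup (GaloisRep.toLocal v ρ) 1) →
        ∃ f : S.X₁ ⟶ (ideleClassLimitShortComplex K).X₂, ∀ v : Place K, R v f = t v)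
    (hR4 : ∀ (f : S.X₁ ⟶ (ideleClassLimitShortComplex K).X₂)
      (ŷ : Abelian.Ext (triv (Γ := absoluteGaloisGroup K) ℤ) S.X₃ 1) (T₀ : Finset (Place K)),
      ∃ (y : galoisCohomology (ρ.tateDual n) 1) (Ty : Finset (Place K)), T₀ ⊆ Ty ∧
        (∀ v : HeightOneSpectrum (𝓞 K), (Sum.inr v : Place K) ∉ Ty →
          galoisCohomology.localization (ρ.tateDual n) (Sum.inr v) 1 y ∈
            unramifiedSubgroup (GaloisRep.toLocal v (ρ.tateDual n)) 1) ∧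
        ((∀ T' : Finset (Place K), Ty ⊆ T' →
            ∑ v ∈ T', localTatePairingZMod ρ n v (LocalInvariants.canonical K n v) (R v f)
              (galoisCohomology.localization (ρ.tateDual n) v 1 y) = 0) →
          inv (ŷ.comp (boundary hS (classBarD K) (f ≫ (ideleClassLimitShortComplex K).g))
            (rfl : 1 + 1 = 2)) = 0)) :
    ∀ T : Finset (Place K), (∀ w : InfinitePlace K, (Sum.inl w : Place K) ∈ T) →
      (∀ v : HeightOneSpectrum (𝓞 K), (Sum.inr v : Place K) ∉ T →
        ((n : ℕ) : 𝓞 K) ∉ v.asIdeal ∧ GaloisRep.IsUnramifiedAt v ρ) →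
      ∀ t : Π v : Place K, galoisCohomology (ρ.toLocal v) 1,
        (∀ v : HeightOneSpectrum (𝓞 K), (Sum.inr v : Place K) ∉ T →
          t (Sum.inr v) ∈ unramifiedSubgroup (GaloisRep.toLocal v ρ) 1) →
        (∀ (y : galoisCohomology (ρ.tateDual n) 1) (T' : Finset (Place K)), T ⊆ T' →
          (∀ v : HeightOneSpectrum (𝓞 K), (Sum.inr v : Place K) ∉ T' →
            galoisCohomology.localization (ρ.tateDual n) (Sum.inr v) 1 y ∈
              unramifiedSubgroup (GaloisRep.toLocal v (ρ.tateDual n)) 1) →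
          ∑ v ∈ T', localTatePairingZMod ρ n v (LocalInvariants.canonical K n v) (t v)
            (galoisCohomology.localization (ρ.tateDual n) v 1 y) = 0) →
        ∃ x : galoisCohomology ρ 1, ∀ v : Place K, galoisCohomology.localization ρ v 1 x = t v := by
  intro T hinf hT t ht horth
  obtain ⟨f, hf⟩ := hR3 T hinf hT t ht
  have hpair : ∀ ŷ : Abelian.Ext (triv (Γ := absoluteGaloisGroup K) ℤ) S.X₃ 1,
      inv (ŷ.comp (boundary hS (classBarD K) (f ≫ (ideleClassLimitShortComplex K).g)) (rfl : 1 + 1 = 2)) = 0 := by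
    intro ŷ
    obtain ⟨y, Ty, hTTy, hyur, himp⟩ := hR4 f ŷ T
    refine himp fun T' hT' => ?_
    have h := horth y T' (hTTy.trans hT') fun v hv => hyur v fun hv' => hv (hT' hv')
    simpa only [hf] using h
  have h0 : boundary hS (classBarD K) (f ≫ (ideleClassLimitShortComplex K).g) = 0 :=
    hα ((adjointMap_eq_zero_of_forall_inv inv _ hpair).trans (map_zero _).symm)
  obtain ⟨h, q, hfq⟩ := exists_eq_add_of_boundary_comp_eq_zero hS
    (ideleClassLimitShortComplex_shortExact K) hP f h0
  obtain ⟨x, hx⟩ := hR2 h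
  refine ⟨x, fun v => ?_⟩
  rw [← hf v, hfq, map_add, hR1, add_zero, hx]

end Inv

/-! ## §2 The road instantiated: door-c4's presentation of `M₀`, the idèle readout, Tate duality -/

section Instantiated

variable (inv : Abelian.Ext (triv (Γ := absoluteGaloisGroup K) ℤ) (classBarD K) 2 →+ AddCircle (1 : ℚ))

/-- **`hA(n, M₀^D)` — the all-places middle exactness for the TATE DUAL of a finite `n`-torsion `M₀` — from:
Tate duality for `(Γ_K, C̄, inv)` (`TateDualityHypotheses`, door-c4), a family of idèle projections
`π v : J̄ → K̄_vˣ`, the (R3) SURJECTIVITY/ASSEMBLY statement for the readout `R_v = readout ρ₀ n hM (π v)` of the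
canonical presentation of `ρ₀`, and the (R4) pairing dictionary for that readout.**  The other four inputs of the
road (`hS`, `hP`, `hR1`, `hR2`) are theorems (`presentationComplex_shortExact`, `ext_presLattice_unitsBarD_eq_zero`,
`readout_f_comp`, `exists_forall_readout_comp_unitsToIdele_eq`).
[cite: MilneADT2006, Ch. I, Lemma 4.13, Thm. 4.10(b) (proof, p. 58), Thm. 1.8][cite: Harari2020, §17.3, Thm. 17.13] -/
theorem middleExact_allPlaces_tateDual_of_ideleProjection
    (hT : TateDualityHypotheses (classBarD K) inv) (π : ∀ v : Place K, IdeleProjection K v)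
    {n : ℕ} [NeZero n] {M : Type} [AddCommGroup M] [TopologicalSpace M] [DiscreteTopology M] [Finite M]
    [Finite (TateDual K M n)] (ρ₀ : DiscreteGaloisModule K M) (hM : ∀ m : M, n • m = 0)
    (hR3 : ∀ T : Finset (Place K), (∀ w : InfinitePlace K, (Sum.inl w : Place K) ∈ T) →
      (∀ v : HeightOneSpectrum (𝓞 K), (Sum.inr v : Place K) ∉ T →
        ((n : ℕ) : 𝓞 K) ∉ v.asIdeal ∧ GaloisRep.IsUnramifiedAt v (ρ₀.tateDual n)) →
      ∀ t : Π v : Place K, galoisCohomology ((ρ₀.tateDual n).toLocal v) 1,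
        (∀ v : HeightOneSpectrum (𝓞 K), (Sum.inr v : Place K) ∉ T →
          t (Sum.inr v) ∈ unramifiedSubgroup (GaloisRep.toLocal v (ρ₀.tateDual n)) 1) →
        ∃ f : (presentationComplex ρ₀).X₁ ⟶ (ideleClassLimitShortComplex K).X₂,
          ∀ v : Place K, readout ρ₀ n hM (π v) f = t v)
    (hR4 : ∀ (f : (presentationComplex ρ₀).X₁ ⟶ (ideleClassLimitShortComplex K).X₂)
      (ŷ : Abelian.Ext (triv (Γ := absoluteGaloisGroup K) ℤ) (presentationComplex ρ₀).X₃ 1) (T₀ : Finset (Place K)),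
      ∃ (y : galoisCohomology ((ρ₀.tateDual n).tateDual n) 1) (Ty : Finset (Place K)), T₀ ⊆ Ty ∧
        (∀ v : HeightOneSpectrum (𝓞 K), (Sum.inr v : Place K) ∉ Ty →
          galoisCohomology.localization ((ρ₀.tateDual n).tateDual n) (Sum.inr v) 1 y ∈
            unramifiedSubgroup (GaloisRep.toLocal v ((ρ₀.tateDual n).tateDual n)) 1) ∧
        ((∀ T' : Finset (Place K), Ty ⊆ T' →
            ∑ v ∈ T', localTatePairingZMod (ρ₀.tateDual n) n v (LocalInvariants.canonical K n v)
              (readout ρ₀ n hM (π v) f)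
              (galoisCohomology.localization ((ρ₀.tateDual n).tateDual n) v 1 y) = 0) →
          inv (ŷ.comp (boundary (presentationComplex_shortExact ρ₀) (classBarD K)
            (f ≫ (ideleClassLimitShortComplex K).g)) (rfl : 1 + 1 = 2)) = 0)) :
    ∀ T : Finset (Place K), (∀ w : InfinitePlace K, (Sum.inl w : Place K) ∈ T) →
      (∀ v : HeightOneSpectrum (𝓞 K), (Sum.inr v : Place K) ∉ T →
        ((n : ℕ) : 𝓞 K) ∉ v.asIdeal ∧ GaloisRep.IsUnramifiedAt v (ρ₀.tateDual n)) →
      ∀ u : Π v : Place K, galoisCohomology ((ρ₀.tateDual n).toLocal v) 1,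
        (∀ v : HeightOneSpectrum (𝓞 K), (Sum.inr v : Place K) ∉ T →
          u (Sum.inr v) ∈ unramifiedSubgroup (GaloisRep.toLocal v (ρ₀.tateDual n)) 1) →
        (∀ (z : galoisCohomology ((ρ₀.tateDual n).tateDual n) 1) (T' : Finset (Place K)), T ⊆ T' →
          (∀ v : HeightOneSpectrum (𝓞 K), (Sum.inr v : Place K) ∉ T' →
            galoisCohomology.localization ((ρ₀.tateDual n).tateDual n) (Sum.inr v) 1 z ∈
              unramifiedSubgroup (GaloisRep.toLocal v ((ρ₀.tateDual n).tateDual n)) 1) →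
          ∑ v ∈ T', localTatePairingZMod (ρ₀.tateDual n) n v (LocalInvariants.canonical K n v) (u v)
            (galoisCohomology.localization ((ρ₀.tateDual n).tateDual n) v 1 z) = 0) →
        ∃ y : galoisCohomology (ρ₀.tateDual n) 1,
          ∀ v : Place K, galoisCohomology.localization (ρ₀.tateDual n) v 1 y = u v := by
  haveI := absoluteGaloisGroup_compactSpace K
  haveI : Finite (presentationComplex ρ₀).X₃.obj.V := ‹Finite M›
  have hα : ExtDuality.AdjointInjective (P := triv (Γ := absoluteGaloisGroup K) ℤ) inv (presentationComplex ρ₀).X₃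
      (rfl : 1 + 1 = 2) :=
    adjointMap_one_injective hT (presentationComplex ρ₀).X₃
  exact middleExact_allPlaces_of_readout_inv inv (ρ₀.tateDual n) (presentationComplex_shortExact ρ₀)
    (fun x => ext_presLattice_unitsBarD_eq_zero (presentationLayer ρ₀) (presentationRank ρ₀) x) hα
    (fun v => readout ρ₀ n hM (π v)) (fun q v => readout_f_comp ρ₀ n hM (π v) q)
    (fun h => exists_forall_readout_comp_unitsToIdele_eq ρ₀ n hM π h) hR3 hR4

/-- **THE NAMED FACT `hE` (`poitouTate_selmerStructure_duality K`: Milne I Cor. 2.3 ∧ Thm. 4.10(b) ∧ Thm. 2.6 ∧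
Howard Thm. 2.1.11 for `K`) from the presentation road**: Tate duality for `(Γ_K, C̄, inv)` (door-c4's record), ONE
family of idèle projections `π v : J̄ → K̄_vˣ` (door-c5), and — for every `n ≥ 1` and every finite `n`-torsion `M₀` —
the (R3) surjectivity/assembly and (R4) pairing statements for the readout of the canonical presentation of `M₀`.
(`poitouTate_selmerStructure_duality_of_allPlaces_tateDual` ∘ `middleExact_allPlaces_tateDual_of_ideleProjection`.)
HONEST FRAMING: a reduction; (R3) and (R4) are genuine remaining inputs.
[cite: MilneADT2006, Ch. I, Thm. 4.10(b), Lemma 4.13, Thm. 1.8][cite: Howard2004HeegnerKolyvagin, Thm. 2.1.11 (arXiv:1202.6340 p. 6)] -/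
theorem poitouTate_selmerStructure_duality_of_ideleProjection
    (hT : TateDualityHypotheses (classBarD K) inv) (π : ∀ v : Place K, IdeleProjection K v)
    (hR3 : ∀ (n : ℕ) [NeZero n],
      ∀ ⦃M : Type⦄ [AddCommGroup M] [TopologicalSpace M] [DiscreteTopology M] [Finite M] [Finite (TateDual K M n)]
      (ρ₀ : DiscreteGaloisModule K M) (hM : ∀ m : M, n • m = 0),
      ∀ T : Finset (Place K), (∀ w : InfinitePlace K, (Sum.inl w : Place K) ∈ T) →
        (∀ v : HeightOneSpectrum (𝓞 K), (Sum.inr v : Place K) ∉ T →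
          ((n : ℕ) : 𝓞 K) ∉ v.asIdeal ∧ GaloisRep.IsUnramifiedAt v (ρ₀.tateDual n)) →
        ∀ t : Π v : Place K, galoisCohomology ((ρ₀.tateDual n).toLocal v) 1,
          (∀ v : HeightOneSpectrum (𝓞 K), (Sum.inr v : Place K) ∉ T →
            t (Sum.inr v) ∈ unramifiedSubgroup (GaloisRep.toLocal v (ρ₀.tateDual n)) 1) →
          ∃ f : (presentationComplex ρ₀).X₁ ⟶ (ideleClassLimitShortComplex K).X₂,
            ∀ v : Place K, readout ρ₀ n hM (π v) f = t v)
    (hR4 : ∀ (n : ℕ) [NeZero n],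
      ∀ ⦃M : Type⦄ [AddCommGroup M] [TopologicalSpace M] [DiscreteTopology M] [Finite M] [Finite (TateDual K M n)]
      (ρ₀ : DiscreteGaloisModule K M) (hM : ∀ m : M, n • m = 0),
      ∀ (f : (presentationComplex ρ₀).X₁ ⟶ (ideleClassLimitShortComplex K).X₂)
        (ŷ : Abelian.Ext (triv (Γ := absoluteGaloisGroup K) ℤ) (presentationComplex ρ₀).X₃ 1) (T₀ : Finset (Place K)),
        ∃ (y : galoisCohomology ((ρ₀.tateDual n).tateDual n) 1) (Ty : Finset (Place K)), T₀ ⊆ Ty ∧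
          (∀ v : HeightOneSpectrum (𝓞 K), (Sum.inr v : Place K) ∉ Ty →
            galoisCohomology.localization ((ρ₀.tateDual n).tateDual n) (Sum.inr v) 1 y ∈
              unramifiedSubgroup (GaloisRep.toLocal v ((ρ₀.tateDual n).tateDual n)) 1) ∧
          ((∀ T' : Finset (Place K), Ty ⊆ T' →
              ∑ v ∈ T', localTatePairingZMod (ρ₀.tateDual n) n v (LocalInvariants.canonical K n v)
                (readout ρ₀ n hM (π v) f)
                (galoisCohomology.localization ((ρ₀.tateDual n).tateDual n) v 1 y) = 0) →
            inv (ŷ.comp (boundary (presentationComplex_shortExact ρ₀) (classBarD K)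
              (f ≫ (ideleClassLimitShortComplex K).g)) (rfl : 1 + 1 = 2)) = 0)) :
    poitouTate_selmerStructure_duality K :=
  poitouTate_selmerStructure_duality_of_allPlaces_tateDual fun n _ _ _ _ _ _ _ ρ₀ hM =>
    middleExact_allPlaces_tateDual_of_ideleProjection inv hT π ρ₀ hM (hR3 n ρ₀ hM) (hR4 n ρ₀ hM)

end Instantiated

/-! ## §3 (R3) from the LOCAL data (`HomDualLocalData`) and the idèle ASSEMBLY -/

section Assembly

/-- **`ρ₀` is unramified at `v ∤ n` as soon as `ρ₀^D` is** (`M₀ ≅ M₀^{DD}`, `exists_bidual_intertwining`, and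
`isUnramifiedAt_tateDual` for `ρ₀^D`). [cite: MilneADT2006, Ch. I §2 (before Thm. 2.6), Prop. 0.19] -/
theorem isUnramifiedAt_of_isUnramifiedAt_tateDual {n : ℕ} [NeZero n]
    {M : Type} [AddCommGroup M] [TopologicalSpace M] [DiscreteTopology M] [Finite M] [Finite (TateDual K M n)]
    (ρ₀ : DiscreteGaloisModule K M) (hM : ∀ m : M, n • m = 0) (v : HeightOneSpectrum (𝓞 K))
    (hv : ((n : ℕ) : 𝓞 K) ∉ v.asIdeal) (hur : GaloisRep.IsUnramifiedAt v (ρ₀.tateDual n)) :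
    GaloisRep.IsUnramifiedAt v ρ₀ := by
  haveI := DiscreteGaloisModule.TateDual.finite K (TateDual K M n) n
  have h2 := isUnramifiedAt_tateDual (ρ₀.tateDual n) v hv hur
  obtain ⟨ι, κ, -, hκι, -⟩ := exists_bidual_intertwining (n := n) ρ₀ hM
  rw [GaloisRep.isUnramifiedAt_iff_toLocal_holds] at h2 ⊢
  intro σ hσ
  refine LinearMap.ext fun m => ?_
  have hιm : ι (ρ₀ (absGaloisRestrict K (v.adicCompletion K) σ) m) =
      ((ρ₀.tateDual n).tateDual n) (absGaloisRestrict K (v.adicCompletion K) σ) (ι m) := by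
    have h0 := congr($(ι.isIntertwining' (absGaloisRestrict K (v.adicCompletion K) σ)) m)
    simp only [ContinuousLinearMap.coe_comp, Function.comp_apply, ContinuousRep.toContRepresentation_apply_apply] at h0
    exact h0
  have h3 : ((ρ₀.tateDual n).tateDual n) (absGaloisRestrict K (v.adicCompletion K) σ) (ι m) = ι m := by
    have := LinearMap.congr_fun (h2 σ hσ) (ι m)
    rwa [GaloisRep.toLocal_apply] at this
  rw [GaloisRep.toLocal_apply, Module.End.one_apply, ← hκι (ρ₀ _ m), hιm, h3, hκι]

variable (inv : Abelian.Ext (triv (Γ := absoluteGaloisGroup K) ℤ) (classBarD K) 2 →+ AddCircle (1 : ℚ))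

/-- **(R3) from the local data and the idèle assembly.**  For the readout `R_v = readout ρ₀ n hM (π v)`:
if every family `(h_v)_v` of `Γ_{K_v}`-equivariant homomorphisms `N₁ → K̄_vˣ` that is UNIT-VALUED at the finite places
outside a finite set `T` is `(π_v ∘ f)_v` for one `f : N₁ ⟶ J̄` (the ASSEMBLY `Hom_{C_Γ}(N₁, J̄) = ∏'_v Hom_{Γ_{K_v}}(N₁, ·)`,
door-c5), then every admissible family of local classes `t ∈ P¹(K, ρ₀^D)` is `(R_v f)_v` — hypothesis `hR3` of the
road: the local classes are local readouts (`localReadout_surjective`), unit-valued at the unramified places outside `T`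
(`exists_unitValued_localReadout_eq`, with `ρ₀` unramified there by `isUnramifiedAt_of_isUnramifiedAt_tateDual`).
[cite: MilneADT2006, Ch. I, Lemma 4.13 (proof)][cite: CasselsFrohlichANT1967, Ch. VII §9.7] -/
theorem exists_readout_eq_of_assembly (π : ∀ v : Place K, IdeleProjection K v)
    {n : ℕ} [NeZero n] {M : Type} [AddCommGroup M] [TopologicalSpace M] [DiscreteTopology M] [Finite M]
    [Finite (TateDual K M n)] (ρ₀ : DiscreteGaloisModule K M) (hM : ∀ m : M, n • m = 0)
    (hAsm : ∀ (T : Finset (Place K))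
      (h : ∀ v : Place K, (haveI := moduleFinite_presModule₁ ρ₀
        (homGaloisModule ((presModule₁ ρ₀).restrictField (Place.Completion v))
          (DiscreteGaloisModule.units (Place.Completion v))).toTopRep.ρ.invariants)),
      (∀ v : HeightOneSpectrum (𝓞 K), (Sum.inr v : Place K) ∉ T → ∀ x : LCarrier (presentationComplex ρ₀).X₁,
        IsNonarchimedeanLocalField.ordQ (v.adicCompletion K)
          ((show LCarrier (presentationComplex ρ₀).X₁ →ₗ[ℤ] DiscreteGaloisModule.UnitsCarrier (v.adicCompletion K) from
            ((h (Sum.inr v)).1 : DiscreteRep.HomCarrier (LCarrier (presentationComplex ρ₀).X₁)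
              (DiscreteGaloisModule.UnitsCarrier (v.adicCompletion K)))) x) = 0) →
      ∃ f : (presentationComplex ρ₀).X₁ ⟶ (ideleClassLimitShortComplex K).X₂, ∀ v : Place K,
        (haveI := moduleFinite_presModule₁ ρ₀; readoutInvariant (π v) (presentationComplex ρ₀).X₁ f) = h v) :
    ∀ T : Finset (Place K), (∀ w : InfinitePlace K, (Sum.inl w : Place K) ∈ T) →
      (∀ v : HeightOneSpectrum (𝓞 K), (Sum.inr v : Place K) ∉ T →
        ((n : ℕ) : 𝓞 K) ∉ v.asIdeal ∧ GaloisRep.IsUnramifiedAt v (ρ₀.tateDual n)) →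
      ∀ t : Π v : Place K, galoisCohomology ((ρ₀.tateDual n).toLocal v) 1,
        (∀ v : HeightOneSpectrum (𝓞 K), (Sum.inr v : Place K) ∉ T →
          t (Sum.inr v) ∈ unramifiedSubgroup (GaloisRep.toLocal v (ρ₀.tateDual n)) 1) →
        ∃ f : (presentationComplex ρ₀).X₁ ⟶ (ideleClassLimitShortComplex K).X₂,
          ∀ v : Place K, readout ρ₀ n hM (π v) f = t v := by
  intro T _ hT t ht
  haveI := moduleFinite_presModule₁ ρ₀
  -- local data at the finite places: unit-valued outside `T`
  have hfin : ∀ v : HeightOneSpectrum (𝓞 K),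
      ∃ hv : (homGaloisModule ((presModule₁ ρ₀).restrictField (Place.Completion (Sum.inr v : Place K)))
          (DiscreteGaloisModule.units (Place.Completion (Sum.inr v : Place K)))).toTopRep.ρ.invariants,
        (haveI : CharZero (Place.Completion (Sum.inr v : Place K)) :=
            charZero_of_algebra (K := K) (Place.Completion (Sum.inr v : Place K));
          localReadout ρ₀ n hM (Place.Completion (Sum.inr v : Place K)) hv) = t (Sum.inr v) ∧
        ((Sum.inr v : Place K) ∉ T → ∀ x : LCarrier (presentationComplex ρ₀).X₁,
          IsNonarchimedeanLocalField.ordQ (v.adicCompletion K)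
            ((show LCarrier (presentationComplex ρ₀).X₁ →ₗ[ℤ] DiscreteGaloisModule.UnitsCarrier (v.adicCompletion K) from
              (hv.1 : DiscreteRep.HomCarrier (LCarrier (presentationComplex ρ₀).X₁)
                (DiscreteGaloisModule.UnitsCarrier (v.adicCompletion K)))) x) = 0) := by
    intro v
    haveI : CharZero (v.adicCompletion K) := charZero_of_algebra (K := K) (v.adicCompletion K)
    -- move `t_v` to the `v.adicCompletion K`-spelling of `K_v` (definitional) before using the local lemmas
    set tv : galoisCohomology ((ρ₀.tateDual n).restrictField (v.adicCompletion K)) 1 := t (Sum.inr v) with htv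
    by_cases hvT : (Sum.inr v : Place K) ∈ T
    · obtain ⟨h, hh⟩ := localReadout_surjective ρ₀ n hM (v.adicCompletion K) tv
      exact ⟨h, hh, fun hvT' => (hvT' hvT).elim⟩
    · obtain ⟨hnv, hurD⟩ := hT v hvT
      have htv' : tv ∈ unramifiedSubgroup ((ρ₀.tateDual n).restrictField (v.adicCompletion K)) 1 := ht v hvT
      obtain ⟨h, hh, hord⟩ := exists_unitValued_localReadout_eq ρ₀ n hM v
        (isUnramifiedAt_of_isUnramifiedAt_tateDual ρ₀ hM v hnv hurD) tv htv'
      exact ⟨h, hh, fun _ => hord⟩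
  -- local data at the infinite places
  have hinf : ∀ w : InfinitePlace K,
      ∃ hv : (homGaloisModule ((presModule₁ ρ₀).restrictField (Place.Completion (Sum.inl w : Place K)))
          (DiscreteGaloisModule.units (Place.Completion (Sum.inl w : Place K)))).toTopRep.ρ.invariants,
        (haveI : CharZero (Place.Completion (Sum.inl w : Place K)) :=
            charZero_of_algebra (K := K) (Place.Completion (Sum.inl w : Place K));
          localReadout ρ₀ n hM (Place.Completion (Sum.inl w : Place K)) hv) = t (Sum.inl w) := by
    intro w
    haveI : CharZero (Place.Completion (Sum.inl w : Place K)) :=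
      charZero_of_algebra (K := K) (Place.Completion (Sum.inl w : Place K))
    exact localReadout_surjective ρ₀ n hM (Place.Completion (Sum.inl w : Place K)) (t (Sum.inl w))
  choose hf hhf hunit using hfin
  choose hi hhi using hinf
  -- assembly
  obtain ⟨f, hf⟩ := hAsm T (fun v => Sum.rec (motive := fun v : Place K =>
      (homGaloisModule ((presModule₁ ρ₀).restrictField (Place.Completion v))
        (DiscreteGaloisModule.units (Place.Completion v))).toTopRep.ρ.invariants) hi hf v)
    (fun v hv x => hunit v hv x)
  refine ⟨f, fun v => ?_⟩
  rw [readout_eq_localReadout, hf v]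
  rcases v with w | v
  · exact hhi w
  · exact hhf v

/-- **THE NAMED FACT `hE` from: Tate duality for `(Γ_K, C̄, inv)`, an idèle projection family `π` with the ASSEMBLY
property, and the (R4) pairing dictionary** (`poitouTate_selmerStructure_duality_of_ideleProjection` with (R3)
discharged by `exists_readout_eq_of_assembly`).  HONEST FRAMING: a reduction; the assembly (door-c5) and (R4)
(door-c4/door-c5) are genuine remaining inputs; BSD is not advanced.
[cite: MilneADT2006, Ch. I, Thm. 4.10(b), Lemma 4.13, Thm. 1.8][cite: Howard2004HeegnerKolyvagin, Thm. 2.1.11 (arXiv:1202.6340 p. 6)] -/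
theorem poitouTate_selmerStructure_duality_of_assembly
    (hT : TateDualityHypotheses (classBarD K) inv) (π : ∀ v : Place K, IdeleProjection K v)
    (hAsm : ∀ (n : ℕ) [NeZero n],
      ∀ ⦃M : Type⦄ [AddCommGroup M] [TopologicalSpace M] [DiscreteTopology M] [Finite M] [Finite (TateDual K M n)]
      (ρ₀ : DiscreteGaloisModule K M) (_hM : ∀ m : M, n • m = 0),
      ∀ (T : Finset (Place K))
        (h : ∀ v : Place K, (haveI := moduleFinite_presModule₁ ρ₀
          (homGaloisModule ((presModule₁ ρ₀).restrictField (Place.Completion v))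
            (DiscreteGaloisModule.units (Place.Completion v))).toTopRep.ρ.invariants)),
        (∀ v : HeightOneSpectrum (𝓞 K), (Sum.inr v : Place K) ∉ T → ∀ x : LCarrier (presentationComplex ρ₀).X₁,
          IsNonarchimedeanLocalField.ordQ (v.adicCompletion K)
            ((show LCarrier (presentationComplex ρ₀).X₁ →ₗ[ℤ] DiscreteGaloisModule.UnitsCarrier (v.adicCompletion K) from
              ((h (Sum.inr v)).1 : DiscreteRep.HomCarrier (LCarrier (presentationComplex ρ₀).X₁)
                (DiscreteGaloisModule.UnitsCarrier (v.adicCompletion K)))) x) = 0) →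
        ∃ f : (presentationComplex ρ₀).X₁ ⟶ (ideleClassLimitShortComplex K).X₂, ∀ v : Place K,
          (haveI := moduleFinite_presModule₁ ρ₀; readoutInvariant (π v) (presentationComplex ρ₀).X₁ f) = h v)
    (hR4 : ∀ (n : ℕ) [NeZero n],
      ∀ ⦃M : Type⦄ [AddCommGroup M] [TopologicalSpace M] [DiscreteTopology M] [Finite M] [Finite (TateDual K M n)]
      (ρ₀ : DiscreteGaloisModule K M) (hM : ∀ m : M, n • m = 0),
      ∀ (f : (presentationComplex ρ₀).X₁ ⟶ (ideleClassLimitShortComplex K).X₂)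
        (ŷ : Abelian.Ext (triv (Γ := absoluteGaloisGroup K) ℤ) (presentationComplex ρ₀).X₃ 1) (T₀ : Finset (Place K)),
        ∃ (y : galoisCohomology ((ρ₀.tateDual n).tateDual n) 1) (Ty : Finset (Place K)), T₀ ⊆ Ty ∧
          (∀ v : HeightOneSpectrum (𝓞 K), (Sum.inr v : Place K) ∉ Ty →
            galoisCohomology.localization ((ρ₀.tateDual n).tateDual n) (Sum.inr v) 1 y ∈
              unramifiedSubgroup (GaloisRep.toLocal v ((ρ₀.tateDual n).tateDual n)) 1) ∧
          ((∀ T' : Finset (Place K), Ty ⊆ T' →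
              ∑ v ∈ T', localTatePairingZMod (ρ₀.tateDual n) n v (LocalInvariants.canonical K n v)
                (readout ρ₀ n hM (π v) f)
                (galoisCohomology.localization ((ρ₀.tateDual n).tateDual n) v 1 y) = 0) →
            inv (ŷ.comp (boundary (presentationComplex_shortExact ρ₀) (classBarD K)
              (f ≫ (ideleClassLimitShortComplex K).g)) (rfl : 1 + 1 = 2)) = 0)) :
    poitouTate_selmerStructure_duality K :=
  poitouTate_selmerStructure_duality_of_ideleProjection inv hT π
    (fun n _ _ _ _ _ _ _ ρ₀ hM => exists_readout_eq_of_assembly π ρ₀ hM (hAsm n ρ₀ hM)) hR4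

end Assembly

end Summit.BirchSwinnertonDyer.BirchSwinnertonDyer.Theorems.SchneiderFreeAdditiveX3.PoitouTateReduction

end
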